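import Literature.MathematicalPhysics.QuantumFieldTheory.Balaban1983to89.B9SectBEGlobAnStepRecordOn

/-!
# `Balaban1983to89.B9SectBKerStepRecordReduction` — the (3.48) block-step `StepKerPos` of the record REDUCED to the coded-carrier step: for C⁻¹ = (Q′G′²Q′*)⁻¹
# the coded and the record readings SHARE the two-point kernel (`pullS 𝔠 Cinv`), so the Step-level transfer has `hout = id` (pub-ymgap N06 row 13, member
# (3.48); the interface the coordinatised re-thread of r06's `B9Thm34Inv` ∕ `thm34_Cinv_uniform` (LOCATED-10, repair R-Ker-1) has to meet)

T. Bałaban, *Propagators for lattice gauge theories in a background field*, Commun. Math. Phys. **99** (1985) 389–434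
[`Balaban1985BackgroundPropagators`, "B9"]; [4] = T. Bałaban, *Propagators and renormalization transformations for lattice gauge
theories. II*, Commun. Math. Phys. **96** (1984) 223–250 [`Balaban1984PropagatorsII`].

statement-level skeleton of published theorems with citation tags; proofs where landed; nothing here is a claim about the
Yang–Mills mass gap

THE PRINTED LOCI.  Theorem 3.2 (3.48) p. 398; Theorem 3.4 p. 400; (3.65)–(3.67) p. 403 (*"The inverse satisfies Theorem 3.2"*); p. 403 l.1–9.

WHY THIS FILE (seat dag-n06-c gen 11; LOCATED-10 on the bus, 2026-08-28).  In the coded-carrier chain the (3.48) family is the record's own two-point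
kernel read along the decoding, `pullS (codingYx …) Cinv`, on BOTH sides of the step; so once a letters-level frame produces
`StepKerPos dB c35 (geo9Y∘f) (codingYx…).bg (KSC …) (pullK GA) (pullS Cinv) (pullS Cinv)` (r06's C⁻¹ clause, after the coordinatised re-thread R-Ker-1 of
LOCATED-10), the record's `StepKerPos … (kernelFamilyS … (GpY par) par) GA Cinv Cinv` follows by the generic transfers of `B9SectBStepPosFamilyTransfer`
with the input domination `B9SectBEGlobAnStepRecordOn.hin_KSC_on_pos` and the IDENTITY output domination.  This file is that reduction (one theorem);
it asserts nothing about C⁻¹ itself.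
Value = bookkeeping (the exact target of R-Ker-1); NOT summit progress; N06 is not discharged by this file.
-/

noncomputable section

namespace Literature.MathematicalPhysics.QuantumFieldTheory.Balaban1983to89.B9SectBKerStepRecordReduction

open Literature.MathematicalPhysics.QuantumFieldTheory.Balaban1983to89
open Literature.MathematicalPhysics.QuantumFieldTheory.Balaban1983to89.B6Ineq2142KLevelV1 (β)
open Literature.MathematicalPhysics.QuantumFieldTheory.Balaban1983to89.B9SectBCodedCarrier (CCfg Coding pullK pullS)
open Literature.MathematicalPhysics.QuantumFieldTheory.Balaban1983to89.B9Eq360DeltaPrimeAY (AfldY)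
open Literature.MathematicalPhysics.QuantumFieldTheory.Balaban1983to89.B9PinMembersKLevelV1 (MemberY geo9Y bg9Y)
open Literature.MathematicalPhysics.QuantumFieldTheory.Balaban1983to89.B9SectBGpLettersY (GVal)
open Literature.MathematicalPhysics.QuantumFieldTheory.Balaban1983to89.B9SectBGpFrameCodedY (codingYx)
open Literature.MathematicalPhysics.QuantumFieldTheory.Balaban1983to89.B9SectBGpReadingsY (KSC)
open Literature.MathematicalPhysics.QuantumFieldTheory.Balaban1983to89.B9SectBEGlobAnStepRecordOn (hin_KSC_on_pos)
open Literature.MathematicalPhysics.QuantumFieldTheory.Balaban1983to89.B9SectBStepPosFamilyTransfer (stepKerPos_of_family_pos stepKerPos_of_coded)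
open Literature.MathematicalPhysics.QuantumFieldTheory.Balaban1983to89.B9SectBStepWhole (StepKerPos)
open Literature.MathematicalPhysics.QuantumFieldTheory.Balaban1983to89.Node00 (SiteY BlkY IBondY CfgY SiteParY kernelFamilyS GpY)

variable {d ℓ : ℕ} {hd : 1 ≤ d + 1} {hL : Odd (ℓ + 1) ∧ 1 < ℓ + 1} {b₀ b₁ : ℝ} {Mstar : ℕ}
variable {𝔸 : Type} [NormedRing 𝔸] [NormedAlgebra ℂ 𝔸] [CompleteSpace 𝔸]

variable {J : Type} (f : J → MemberY d ℓ hd hL b₀ b₁ Mstar) [∀ x : MemberY d ℓ hd hL b₀ b₁ Mstar, Fintype (geo9Y x).Site]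
  (c35 : ℝ) (G : Subgroup 𝔸ˣ) (par : ∀ j : J, SiteParY 𝔸 (f j).toKIdx) {ι : Type} [Fintype ι] (b : Module.Basis ι ℝ 𝔸)
  (ιB : ∀ j : J, BlkY (f j).toKIdx → IBondY (f j).toKIdx)
  (C37 C38 : ∀ j : J, ℝ → CfgY 𝔸 (f j).toKIdx → AfldY 𝔸 (f j).toKIdx → Prop)

/-- ★★ **`StepKerPos` OF THE RECORD FAMILY ON A SUBFAMILY, REDUCED TO THE CODED STEP** (input families: the record's `kernelFamilyS … (GpY par) par`, `GA`,
`Cinv` over `bg9Y`; output: the record's (3.48) kernel `Cinv` at `U′U`): IF the (3.48) block-step holds over the coded carriers for the coded readings `KSC`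
with the shared families `pullK GA`, `pullS Cinv` (input) and `pullS Cinv` (output) — the letters-level C⁻¹ frame's output, R-Ker-1's target — THEN it holds for
the record, under the class implication `hclass` (discharged for `C37Y` in `B9SectBCodedChainC37Y`): `stepKerPos_of_coded ∘ stepKerPos_of_family_pos` with
`hin_KSC_on_pos` and the identity output domination (the output kernel is the same function on both sides).
[cite: Balaban1985BackgroundPropagators, Thm 3.2 (3.48) p.398, Thm 3.4 p.400, (3.65)–(3.67) p.403, p.403 l.1–9, (3.35)–(3.37) p.396; Balaban1984PropagatorsII, (2.51) p.232] -/
theorem stepKerPos_record_on_of_KSC (hι : ∀ (j : J) (s : BlkY (f j).toKIdx), β (f j).toKIdx.hN (f j).toKIdx.D (f j).toKIdx.hk (ιB j s) = s)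
    (hG1 : ∀ u : 𝔸ˣ, u ∈ G → ‖(u : 𝔸)‖ ≤ 1) {M₂ : ℝ} (hM₂ : 0 ≤ M₂) (hrepr : ∀ (v : 𝔸) (j : ι), |b.repr v j| ≤ M₂ * ‖v‖) (dB : ℕ)
    (GA : ∀ j : J, B9.KernelFamily (geo9Y (f j)) (bg9Y 𝔸 G (f j))) (Cinv : ∀ j : J, B9.SiteKernel (geo9Y (f j)) (bg9Y 𝔸 G (f j)))
    {r αcap Mc ac : ℝ} (hr : 0 < r) (hcap : 0 < αcap) (hac : 0 < ac)
    (hclass : ∀ (j : J) (α₀ α₁ : ℝ) (U U' : (bg9Y 𝔸 G (f j)).Cfg), Mc ≤ (geo9Y (f j)).M → 0 < α₀ → (geo9Y (f j)).M * α₀ ≤ ac →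
      (bg9Y 𝔸 G (f j)).Reg335 c35 α₀ U → 0 < α₁ → α₁ ≤ αcap → (bg9Y 𝔸 G (f j)).Cplx337 α₁ U U' →
      ∃ a : (codingYx G (f j) (C37 j) (C38 j)).A,
        (codingYx G (f j) (C37 j) (C38 j)).decA a = U' ∧ (codingYx G (f j) (C37 j) (C38 j)).C37 (r * α₁) U a)
    (h : StepKerPos dB c35 (fun j => geo9Y (f j)) (fun j => (codingYx G (f j) (C37 j) (C38 j)).bg) (fun j => KSC G (f j) (par j) (C37 j) (C38 j))
      (fun j => pullK (codingYx G (f j) (C37 j) (C38 j)) (GA j)) (fun j => pullS (codingYx G (f j) (C37 j) (C38 j)) (Cinv j))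
      (fun j => pullS (codingYx G (f j) (C37 j) (C38 j)) (Cinv j))) :
    StepKerPos dB c35 (fun j => geo9Y (f j)) (fun j => bg9Y 𝔸 G (f j))
      (fun j => kernelFamilyS (f j).toKIdx (bg9Y 𝔸 G (f j)) (fun U => U) (GpY (f j).toKIdx (par j)) (par j)) GA Cinv Cinv := by
  refine stepKerPos_of_coded dB c35 (fun j => geo9Y (f j)) (fun j => bg9Y 𝔸 G (f j))
    (fun j => kernelFamilyS (f j).toKIdx (bg9Y 𝔸 G (f j)) (fun U => U) (GpY (f j).toKIdx (par j)) (par j)) GA Cinv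
    (fun j => codingYx G (f j) (C37 j) (C38 j)) hr hcap hac hclass Cinv ?_
  refine stepKerPos_of_family_pos dB c35 (fun j => geo9Y (f j)) (fun j => (codingYx G (f j) (C37 j) (C38 j)).bg)
    (fun j => KSC G (f j) (par j) (C37 j) (C38 j))
    (fun j => pullK (codingYx G (f j) (C37 j) (C38 j)) (kernelFamilyS (f j).toKIdx (bg9Y 𝔸 G (f j)) (fun U => U) (GpY (f j).toKIdx (par j)) (par j)))
    (fun j => pullK (codingYx G (f j) (C37 j) (C38 j)) (GA j)) (fun j => pullK (codingYx G (f j) (C37 j) (C38 j)) (GA j))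
    (fun j => pullS (codingYx G (f j) (C37 j) (C38 j)) (Cinv j))
    (hin_KSC_on_pos f c35 G par b ιB C37 C38 hι hG1 hM₂ hrepr dB _ _)
    (fun j => pullS (codingYx G (f j) (C37 j) (C38 j)) (Cinv j)) (fun j => pullS (codingYx G (f j) (C37 j) (C38 j)) (Cinv j))
    (fun B δ a hB hδ ha => ⟨0, 1, a, B, δ, one_pos, ha, le_rfl, hB, hδ, fun _ _ _ _ _ _ _ _ _ _ _ _ hK => hK⟩) h

end Literature.MathematicalPhysics.QuantumFieldTheory.Balaban1983to89.B9SectBKerStepRecordReduction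

end
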